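import Summits.AtomisticToContinuum.HydrodynamicLimit.Theorems.CollisionIsometryCLTCollisionalTransferLocalityDefsE
import Summits.AtomisticToContinuum.HydrodynamicLimit.Theorems.CollisionIsometryCLTCollisionalTransferLocalityJumpIncrements
import HarnessLib

/-!
# [DomA]: the isotropic mark sum dominates the increments of every `A`-mark sum
(line `hemisphere-affine-slaving`, crux `CollisionalTransferLocality`, stmt-AtomisticToContinuum-9518)

Helper file (`--supports stmt-AtomisticToContinuum-9518`; registered stub `stub_markDominationA`) of the line lead,
continuing `…DefsE` (the mark kernel `markA σ A` with a general matrix weight `A`, its normalised collision sum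
`MfunA`, the isotropic weight `isoW`) and `…JumpIncrements` (window bookkeeping on a good orbit).

Deterministic collision bookkeeping on a GOOD orbit, for a matrix weight `A` with `|A(s, x)_ab| ≤ CA` on `[0, t]`:
* `abs_sum_sum_mul_mul_le` — the quadratic-form bound `|Σ_ab n_a n_b B_ab| ≤ 9 CA ‖n‖²` on `ℝ³`
  (`Σ_a |n_a| ≤ 3 ‖n‖`);
* `abs_markA_le_markA_isoW` — PER ORDERED PAIR: `|markA σ A N s w i j| ≤ 9 CA · markA σ isoW N s w i j`
  (the common factor `(ε_N/2) ‖Δv_i‖ ≥ 0`, and `markA σ isoW = (ε_N/2) ‖Δv_i‖ ‖ω‖²`);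
* `collisionPairSum_markA_isoW_nonneg`, `abs_collisionPairSum_markA_le` — the window forms on a good orbit
  (finitely many collision times in `(τ, τ']`, each collision time lies in `[0, t]` when `0 ≤ τ`, `τ' ≤ t`);
* `stub_markDominationA` (registered) — for `0 ≤ τ ≤ τ' ≤ t`: `M^{isoW}_N(z, ·)` is monotone and
  `|M^A_N(z, τ') − M^A_N(z, τ)| ≤ 9 CA (M^{isoW}_N(z, τ') − M^{isoW}_N(z, τ))` — both differences are the
  normalised collision pair sums over the window `(τ, τ']` (`collisionPairSum_Ioc_split`).
References: Spohn (1991) Part I §3.2; Chapman–Cowling (1970) §16.4.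
-/

namespace Summit.AtomisticToContinuum.HydrodynamicLimit.Theorems.HemisphereAffineSlaving

open scoped BigOperators Topology Classical ENNReal InnerProductSpace
open Filter Set Function MeasureTheory
open Literature.Analysis.FunctionSpaces Literature.Analysis.FluidPDE

noncomputable section

open Literature.MathematicalPhysics.KineticTheory (T3 V3 hsDiameter hsDiameter_pos)

/-! ## The one-pair estimate -/

section OnePair

/-- **The quadratic-form bound on `ℝ³`.** If `|B_ab| ≤ CA` for all `a, b` (`CA ≥ 0`), then
`|Σ_a Σ_b n_a n_b B_ab| ≤ CA (Σ_a |n_a|)² ≤ 9 CA ‖n‖²` (`Σ_a |n_a| ≤ 3 ‖n‖`, `sum_abs_le_three_mul_norm`). -/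
theorem abs_sum_sum_mul_mul_le {CA : ℝ} (hCA : 0 ≤ CA) {B : Fin 3 → Fin 3 → ℝ}
    (hB : ∀ a b, |B a b| ≤ CA) (n : V3) :
    |∑ a, ∑ b, n a * n b * B a b| ≤ 9 * CA * ‖n‖ ^ 2 := by
  have hS : ∑ a, |n a| ≤ 3 * ‖n‖ := sum_abs_le_three_mul_norm n
  have hS0 : 0 ≤ ∑ a, |n a| := Finset.sum_nonneg fun a _ => abs_nonneg _
  calc |∑ a, ∑ b, n a * n b * B a b|
      ≤ ∑ a, |∑ b, n a * n b * B a b| := Finset.abs_sum_le_sum_abs _ _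
    _ ≤ ∑ a, ∑ b, |n a * n b * B a b| :=
        Finset.sum_le_sum fun a _ => Finset.abs_sum_le_sum_abs _ _
    _ ≤ ∑ a, ∑ b, |n a| * |n b| * CA :=
        Finset.sum_le_sum fun a _ => Finset.sum_le_sum fun b _ => by
          rw [abs_mul, abs_mul]
          exact mul_le_mul_of_nonneg_left (hB a b) (by positivity)
    _ = CA * (∑ a, |n a|) ^ 2 := by
        rw [sq, Finset.sum_mul_sum, Finset.mul_sum]
        refine Finset.sum_congr rfl fun a _ => ?_
        rw [Finset.mul_sum]
        exact Finset.sum_congr rfl fun b _ => by ring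
    _ ≤ CA * (3 * ‖n‖) ^ 2 := by gcongr
    _ = 9 * CA * ‖n‖ ^ 2 := by ring

/-- **The one-pair estimate.** For `σ ≥ 0` and a weight slice with `|A(s, x)_ab| ≤ CA` (`CA ≥ 0`):
`|markA σ A N s w i j| ≤ 9 CA · markA σ isoW N s w i j` — the common factor `(ε_N/2) ‖Δv_i‖` is
nonnegative, `|Σ_ab ω_a ω_b A_ab| ≤ 9 CA ‖ω‖²`, and `markA σ isoW = (ε_N/2) ‖Δv_i‖ ‖ω‖²` (`markA_isoW`). -/
theorem abs_markA_le_markA_isoW {σ : ℝ} (hσ : 0 ≤ σ) {CA : ℝ} (hCA : 0 ≤ CA)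
    {A : ℝ → T3 → Fin 3 → Fin 3 → ℝ} {s : ℝ} (hA : ∀ (x : T3) (a b : Fin 3), |A s x a b| ≤ CA)
    (N : ℕ) (w : Cfg N) (i j : Fin (N + 1)) :
    |markA σ A N s w i j| ≤ 9 * CA * markA σ isoW N s w i j := by
  have hε : 0 ≤ hsDiameter σ N := by
    unfold Literature.MathematicalPhysics.KineticTheory.hsDiameter
    positivity
  have hc : 0 ≤ hsDiameter σ N / 2 * ‖dV N w i j‖ := by positivity
  rw [markA_isoW, markA, abs_mul, abs_of_nonneg hc]
  calc hsDiameter σ N / 2 * ‖dV N w i j‖ *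
        |∑ a, ∑ b, omg N w i j a * omg N w i j b * A s (w i).1 a b|
      ≤ hsDiameter σ N / 2 * ‖dV N w i j‖ * (9 * CA * ‖omg N w i j‖ ^ 2) :=
        mul_le_mul_of_nonneg_left (abs_sum_sum_mul_mul_le hCA (hA (w i).1) (omg N w i j)) hc
    _ = 9 * CA * (hsDiameter σ N / 2 * ‖dV N w i j‖ * ‖omg N w i j‖ ^ 2) := by ring

end OnePair

/-! ## Summation over the collisions of a good orbit in a window `(τ, τ']` -/

section Orbit

/-- The collision pair sum of the isotropic mark kernel over any window is nonnegative (`σ ≥ 0`;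
nonnegative kernel, `markA_isoW_nonneg`). -/
theorem collisionPairSum_markA_isoW_nonneg {σ : ℝ} (hσ : 0 ≤ σ) (Φ : Flows σ) (N : ℕ) (z : Cfg N)
    (S : Set ℝ) : 0 ≤ (Φ N).collisionPairSum S (markA σ isoW N) z := by
  unfold HardSphereFlow.collisionPairSum
  exact collisionPairSum_nonneg fun tc i j => markA_isoW_nonneg hσ N tc _ i j

/-- **The window form on a good orbit.** For `σ > 0`, a flow family, a good initial datum, a weight with
`|A(s, x)_ab| ≤ CA` (`CA ≥ 0`) for `s ∈ [0, t]`, and a window `(τ, τ']` with `0 ≤ τ`, `τ' ≤ t`: the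
collision pair sum of `markA σ A` over the window is at most `9 CA` times that of `markA σ isoW` in absolute
value (finitely many collision times, each in `[0, t]`; `abs_markA_le_markA_isoW` pair by pair). -/
theorem abs_collisionPairSum_markA_le {σ : ℝ} (hσ : 0 < σ) (Φ : Flows σ) {N : ℕ} {z : Cfg N}
    (hz : z ∈ (Φ N).good) {t CA : ℝ} {A : ℝ → T3 → Fin 3 → Fin 3 → ℝ} (hCA : 0 ≤ CA)
    (hA : ∀ s ∈ Icc 0 t, ∀ (x : T3) (a b : Fin 3), |A s x a b| ≤ CA) {τ τ' : ℝ} (hτ : 0 ≤ τ)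
    (hτ't : τ' ≤ t) :
    |(Φ N).collisionPairSum (Ioc τ τ') (markA σ A N) z| ≤
      9 * CA * (Φ N).collisionPairSum (Ioc τ τ') (markA σ isoW N) z := by
  have htraj := (Φ N).isTrajectory z hz
  have hfin := htraj.finite_collisionTimes_inter_Ioc τ τ'
  unfold HardSphereFlow.collisionPairSum
  rw [collisionPairSum_eq_finset_sum hfin, collisionPairSum_eq_finset_sum hfin, Finset.mul_sum]
  refine (Finset.abs_sum_le_sum_abs _ _).trans (Finset.sum_le_sum fun tc htc => ?_)
  -- one collision time, which lies in `[0, t]`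
  have htcI : tc ∈ Ioc τ τ' := ((Set.Finite.mem_toFinset hfin).1 htc).2
  have hs : tc ∈ Icc 0 t := ⟨hτ.trans htcI.1.le, htcI.2.trans hτ't⟩
  rw [Finset.mul_sum]
  refine (Finset.abs_sum_le_sum_abs _ _).trans (Finset.sum_le_sum fun e _ => ?_)
  exact abs_markA_le_markA_isoW hσ.le hCA (hA tc hs) N _ e.1 e.2

end Orbit

/-! ## The registered stub -/

/-- **Registered stub `stub_markDominationA` [DomA] — THE ISOTROPIC MARK SUM DOMINATES THE INCREMENTS OF
THE `A`-MARK SUM.** For `0 < σ ≤ 1/2`, a flow family, a good initial datum, a matrix weight `A` with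
`|A(s, x)_ab| ≤ CA` (`CA ≥ 0`) for `s ∈ [0, t]`, and `0 ≤ τ ≤ τ' ≤ t`: the isotropic mark sum is monotone,
`M^{isoW}_N(z, τ) ≤ M^{isoW}_N(z, τ')`, and
`|M^A_N(z, τ') − M^A_N(z, τ)| ≤ 9 CA (M^{isoW}_N(z, τ') − M^{isoW}_N(z, τ))` — both differences are the
normalised collision pair sums over the window `(τ, τ']` (`collisionPairSum_Ioc_split`), the isotropic kernel
`(ε_N/2) ‖Δv_i‖ ‖ω‖²` is nonnegative, and pair by pair `|(ε_N/2) ‖Δv_i‖ Σ_ab ω_a ω_b A_ab| ≤ 9 CA (ε_N/2) ‖Δv_i‖ ‖ω‖²`.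
[folklore; Spohn (1991) I §3.2] -/
theorem stub_markDominationA : ∀ (σ : ℝ), 0 < σ → σ ≤ 1 / 2 → ∀ (Φ : Flows σ) (N : ℕ) (z : Cfg N), z ∈ (Φ N).good → ∀ (t CA : ℝ) (A : ℝ → T3 → Fin 3 → Fin 3 → ℝ), 0 ≤ CA → (∀ s ∈ Icc 0 t, ∀ (x : T3) (a b : Fin 3), |A s x a b| ≤ CA) → ∀ τ τ' : ℝ, 0 ≤ τ → τ ≤ τ' → τ' ≤ t → MfunA σ Φ isoW N z τ ≤ MfunA σ Φ isoW N z τ' ∧ |MfunA σ Φ A N z τ' - MfunA σ Φ A N z τ| ≤ 9 * CA * (MfunA σ Φ isoW N z τ' - MfunA σ Φ isoW N z τ) := by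
  intro σ hσ _hσ2 Φ N z hz t CA A hCA hA τ τ' hτ hττ' hτ't
  set c : ℝ := ((N : ℝ) + 1)⁻¹ with hcdef
  have hc0 : 0 ≤ c := by positivity
  have hM : MfunA σ Φ A N z τ' - MfunA σ Φ A N z τ =
      c * (Φ N).collisionPairSum (Ioc τ τ') (markA σ A N) z := by
    unfold MfunA
    rw [collisionPairSum_Ioc_split Φ hz hτ hττ', ← hcdef]
    ring
  have hI : MfunA σ Φ isoW N z τ' - MfunA σ Φ isoW N z τ =
      c * (Φ N).collisionPairSum (Ioc τ τ') (markA σ isoW N) z := by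
    unfold MfunA
    rw [collisionPairSum_Ioc_split Φ hz hτ hττ', ← hcdef]
    ring
  refine ⟨?_, ?_⟩
  · have h : 0 ≤ c * (Φ N).collisionPairSum (Ioc τ τ') (markA σ isoW N) z :=
      mul_nonneg hc0 (collisionPairSum_markA_isoW_nonneg hσ.le Φ N z (Ioc τ τ'))
    rw [← hI] at h
    linarith
  · rw [hM, hI, abs_mul, abs_of_nonneg hc0, mul_left_comm (9 * CA) c]
    exact mul_le_mul_of_nonneg_left (abs_collisionPairSum_markA_le hσ Φ hz hCA hA hτ hτ't) hc0

end

end Summit.AtomisticToContinuum.HydrodynamicLimit.Theorems.HemisphereAffineSlaving
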